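import Summits.HodgeConjecture.HodgeConjecture.Theorems.TropicalKugaSatakeCayleyKontsevichTransferKSGenericMemberForms
import Summits.HodgeConjecture.HodgeConjecture.Theorems.TropicalKugaSatakeCayleyKontsevichTransferKSEffectiveSpan
import Summits.HodgeConjecture.HodgeConjecture.Theorems.TropicalKugaSatakeCayleyKontsevichTransferKSNoWeightDrop
import Literature.AlgebraicGeometry.HodgeTheory.ComplexTorusRationalClassesComparison
import Literature.AlgebraicGeometry.HodgeTheory.MotivatedClassesHodgeClassesHolds
import Literature.AlgebraicGeometry.HodgeTheory.RationallyNormalisedDeRhamFamily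
import Mathlib

/-!
# Route `TropicalKugaSatakeCayley`, crux K2 `KontsevichTransferKS` (stmt-HodgeConjecture-18570), line `birth`:
# the VERY GENERAL member of the Kuga–Satake family is Hodge-generic — part 3: CLAUSE (i) of
# `stub_kontsevichShadow` for the algebraic classes of every model, and THE CRUX FROM CLAUSE (ii) ALONE

The load-bearing stub `stub_kontsevichShadow` of `Cruxes/KontsevichTransferKS/Lines/birth.lean` asks for
`z ∈ T = {Im z ∈ ksPosCone}` such that for every Kuga–Satake period map `Φ` of `z` and every smooth
projective model `(X, φ)` of `ℂ⁸/(ℤ⁸ ⊕ τ(z)ℤ⁸)` there is a natural complex de Rham family `e` with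
(i) `∀ c ∈ algebraicClasses X 6, constFormEquiv Φ φ hφ e c ∈ flatHodgeForms` and (ii) the shadow
property. This file PROVES CLAUSE (i) — with the skeleton's file-local `constFormEquiv`,
`flatHodgeForms`, `IsFlatHodge`, `pullForm` UNFOLDED — at every very general point (densely), and then
runs the skeleton's composition on clause (ii) ALONE:

* `kgm_constForm_of_rational_hodgeClass` — for a rational class of Hodge type `(p,p)` on a smooth
  projective model `X` of the torus `ℂ⁸/Φ(ℤ¹⁶)` and a natural rationally normalised family `e`, the
  constant form `ω_c = ((cconstClassEquiv Φ)⁻¹ (e⁻¹ (φ^* c))) ∘ Φ` on `Λ_ℝ` has RATIONAL values on the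
  standard basis tuples and `ω_c ∘ Φ⁻¹` is of type `(p,p)` (model independence of Hodge types read on
  the torus Hodge model, `isOfHodgeType_iff_mem_hodgePQ`; `H^{p,q} = [Λ^{p,q}]`,
  `cconstClass_mem_hodgePQ_iff`; rational classes = invariant forms with rational periods,
  `isRationalClass_iff_mem_rationalForms_of_isRational`, Lange–Birkenhake 1.1.20 / 1.1.21);
* `kontsevichTransferKS_exists_genericMember_forall` / `kontsevichTransferKS_exists_genericMember`
  (`∀ e` natural rationally normalised / `∃ e`, the stub's shape) — **in every open set meeting `T`
  there is `z₀ ∈ T` such that for every KS period map `Φ` of `z₀`, every smooth projective model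
  `(X, φ)`, and every (resp. some) natural rationally normalised family `e`, the constant form of
  EVERY ALGEBRAIC CLASS `c ∈ algebraicClasses X 6` lies in the `ℂ`-span of the flat Hodge forms**
  (algebraic classes lie in the span of the rational `(6,6)`-classes,
  `algebraicClasses_le_span_hodgeClasses`; part 2's `kontsevichTransferKS_exists_genericMember_forms`
  makes their rational `(6,6)` constant forms flat). The registered clause (i) follows by the one-liner
  (kernel-checked in the seat against verbatim copies of the skeleton's definitions, std axioms):
  `obtain ⟨z₀, -, hz₀, h⟩ := kontsevichTransferKS_exists_genericMember Set.univ isOpen_univ ⟨_, Set.mem_univ _, ktks_axisParam_mem_ksPosCone one_pos⟩; exact ⟨z₀, hz₀, fun Φ hΦ X hX φ hφ => h Φ hΦ X hX φ hφ⟩`;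
* `kontsevichTransferKS_of_shadows` — **THE CRUX `KontsevichTransferKS` (BY NAME) FROM CLAUSE (ii)
  ALONE**: with stubs 1 and 2 landed (`kontsevichTransferKS_effectiveSpan`,
  `kontsevichTransferKS_noWeightDrop`) and clause (i) above, the skeleton's composition
  `KontsevichTransferKS_of` runs on the single displayed hypothesis "every finite family of effective
  surface classes `g_* 1_V` of every model of every member is shadowed, on a non-empty open set of cusp
  parameters, by effective tropical `(2,2)`-cycles whose period classes read out the tropical
  `(6,6)`-blocks of their constant forms through one injective `ℝ`-linear `Λ`" — clause (ii) with
  `effectiveClasses` and `tropClass` unfolded, required only on some OPEN set `W` of parameters meeting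
  the tube domain (e.g. a neighbourhood of the cusp), for every natural rationally normalised `e`; a
  very general `z₀ ∈ W` is then chosen. The line `birth` is thereby reduced to this one statement.

No definition, no named fact, no sorry.

## References

* [vanGeemenVerra2003QuaternionicPryms] B. van Geemen, A. Verra, Quaternionic Pryms and Hodge classes,
  Topology 42 (2003), §6.1, Rem. 6.6, §6.7.
* [LangeBirkenhake1992] H. Lange, Ch. Birkenhake, Complex Abelian Varieties (1992), §1.1.4
  Prop. 1.1.20, §1.1.5 Thm. 1.1.21, §17.1.
* [MikhalkinZharkov2014Eigenwave] G. Mikhalkin, I. Zharkov, Tropical eigenwave … (2014), §7.1.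
* [Zharkov2020TropicalWeil] I. Zharkov, Tropical abelian varieties, Weil classes …, arXiv:2002.02347.
-/

noncomputable section

set_option linter.dupNamespace false

namespace Summit.HodgeConjecture.HodgeConjecture.Theorems

open Literature.AlgebraicGeometry.Tropical Literature.AlgebraicGeometry.Tropical.TropicalTorus
open Literature.Geometry.Kaehler
open scoped Matrix

/-! ### §7 From classes on a model to constant forms: clause (i) of `stub_kontsevichShadow` -/

section Classes

open Literature.AlgebraicGeometry Literature.AlgebraicGeometry.HodgeTheory
open Literature.NumberTheory.Transcendental Literature.AlgebraicTopology.SingularHomology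
open CategoryTheory

/-- **Rational `(p,p)`-classes of a model have rational constant forms of type `(p,p)`.** Let the torus
`ℂ⁸/Φ(ℤ¹⁶)` be the analytification `φ` of a smooth projective `X` of dimension `8`, and `e` a natural,
rationally normalised complex de Rham family on `ℂ⁸`-manifolds. For a rational class `c` of Hodge type
`(p,p)` on `X` (`k = p + p`), the constant form `ω_c = (e⁻¹ φ^* c)^{inv} ∘ Φ` on `Λ_ℝ` (the skeleton's
`constFormEquiv Φ φ hφ e c`) takes rational values on the standard basis tuples and `ω_c ∘ Φ⁻¹` is of
type `(p,p)` (model independence of Hodge types, `isOfHodgeType_iff_mem_hodgePQ`, read on the torus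
model; `H^{p,q} = [Λ^{p,q}]`, `cconstClass_mem_hodgePQ_iff`; rational classes = invariant forms with
rational periods, `isRationalClass_iff_mem_rationalForms_of_isRational`).
[cite: LangeBirkenhake1992, §1.1.4 Prop. 1.1.20 and §1.1.5 Thm. 1.1.21] -/
theorem kgm_constForm_of_rational_hodgeClass
    (Φ : (Fin 8 ⊕ Fin 8 → ℝ) ≃L[ℝ] (Fin 8 → ℂ)) {X : Motives.SchemeOver ℂ}
    (hX : Motives.IsSmoothProjective 8 X) (φ : ComplexTorus Φ → Motives.ComplexPoints X)
    (hφ : IsAnalytification (Fin 8 → ℂ) X 8 φ) {e : ComplexDeRhamIsoFamily (Fin 8 → ℂ)}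
    (he : e.IsNatural) (hrate : ∀ k, IsRationalDeRhamFamily e k) {k p : ℕ} (hk : p + p = k)
    {c : complexBetti X k} (hrat : IsRationalClass c) (htype : IsOfHodgeType 8 X k p p c) :
    (∀ v : Fin k → Fin 8 ⊕ Fin 8,
      (((ComplexTorus.cconstClassEquiv Φ).symm ((e (ComplexTorus Φ) k).symm
        ((singularCohomology.mapIso (R := ℂ) (M := ℂ) (IsHomeomorph.homeomorph φ hφ.isHomeomorph) k).toLinearEquiv c))).compContinuousLinearMap
          (Φ : (Fin 8 ⊕ Fin 8 → ℝ) →L[ℝ] (Fin 8 → ℂ))) (fun j => Pi.single (v j) (1 : ℝ)) ∈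
        Set.range (algebraMap ℚ ℂ)) ∧
    ComplexTorus.IsConstOfType p p
      ((((ComplexTorus.cconstClassEquiv Φ).symm ((e (ComplexTorus Φ) k).symm
        ((singularCohomology.mapIso (R := ℂ) (M := ℂ) (IsHomeomorph.homeomorph φ hφ.isHomeomorph) k).toLinearEquiv c))).compContinuousLinearMap
          (Φ : (Fin 8 ⊕ Fin 8 → ℝ) →L[ℝ] (Fin 8 → ℂ))).compContinuousLinearMap
        (Φ.symm : (Fin 8 → ℂ) →L[ℝ] (Fin 8 ⊕ Fin 8 → ℝ))) := by
  classical
  -- the Hodge model of `X` on the torus, with de Rham family `e`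
  let B : HodgeModel 8 X :=
    { model := Fin 8 → ℂ, carrier := ComplexTorus Φ, toComplexPoints := φ, isAnalytification := hφ,
      deRham := e, deRham_isNatural := he, isInternal_hodgePQ := ComplexTorus.isInternal_hodgePQ Φ }
  let hT : ComplexTorus Φ ≃ₜ Motives.ComplexPoints X := IsHomeomorph.homeomorph φ hφ.isHomeomorph
  set x := (singularCohomology.mapIso (R := ℂ) (M := ℂ) hT k).toLinearEquiv c with hxdef
  set γ := (ComplexTorus.cconstClassEquiv Φ).symm ((e (ComplexTorus Φ) k).symm x) with hγdef
  -- `x = φ^* c`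
  have hcont : (⟨φ, hφ.isHomeomorph.continuous⟩ : C(ComplexTorus Φ, Motives.ComplexPoints X)) =
      (hT : C(ComplexTorus Φ, Motives.ComplexPoints X)) := by
    ext y
    rfl
  have hx : x = B.pullback k c := by
    simp only [hxdef, HodgeModel.pullback, Iso.toLinearEquiv_apply, singularCohomology.mapIso_hom, B,
      hcont]
  -- `e [γ] = x`
  have heγ : e (ComplexTorus Φ) k (ComplexTorus.cconstClass Φ γ) = x := by
    rw [hγdef, ← ComplexTorus.cconstClassEquiv_apply, LinearEquiv.apply_symm_apply,
      LinearEquiv.apply_symm_apply]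
  -- the constant form restricted back along `Φ⁻¹` is `γ`
  have hback : (γ.compContinuousLinearMap (Φ : (Fin 8 ⊕ Fin 8 → ℝ) →L[ℝ] (Fin 8 → ℂ))).compContinuousLinearMap
      (Φ.symm : (Fin 8 → ℂ) →L[ℝ] (Fin 8 ⊕ Fin 8 → ℝ)) = γ := by
    ext v
    simp [Function.comp_def]
  refine ⟨fun v => ?_, ?_⟩
  · -- rationality: `x = φ^* c` is rational, so `γ ∈ Hᵏ(T, ℚ)`, i.e. rational periods
    have hxrat : IsRationalClass x := by
      rw [hx]
      exact hrat.pullback _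
    rw [← heγ] at hxrat
    have hγrat : γ ∈ ComplexTorus.rationalForms Φ k :=
      (isRationalClass_iff_mem_rationalForms_of_isRational Φ he (hrate k)).1 hxrat
    letI : LinearOrder (Fin 8 ⊕ Fin 8) :=
      LinearOrder.lift' (finSumFinEquiv (m := 8) (n := 8)) finSumFinEquiv.injective
    have hv := (ComplexTorus.mem_rationalForms_iff_forall_single Φ).1 hγrat v
    have hv' : (γ fun j => Φ (Pi.single (v j) (1 : ℝ))) ∈ Set.range (algebraMap ℚ ℂ) := by
      convert hv using 5
    simpa only [ContinuousAlternatingMap.compContinuousLinearMap_apply, Function.comp_def,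
      ContinuousLinearEquiv.coe_coe] using hv'
  · -- type: model independence on the torus model, then `H^{p,p} = [Λ^{p,p}]`
    rw [hback]
    have hmem : B.pullback k c ∈ B.hodgePQ k p p := (isOfHodgeType_iff_mem_hodgePQ hX B c).1 htype
    have hmem' : x ∈ (hodgePQ (Fin 8 → ℂ) (ComplexTorus Φ) k p p).map
        (e (ComplexTorus Φ) k).toLinearMap := by
      rw [hx]
      exact hmem
    obtain ⟨y, hy, hyx⟩ := Submodule.mem_map.1 hmem'
    have hyeq : y = ComplexTorus.cconstClass Φ γ := by
      apply (e (ComplexTorus Φ) k).injective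
      rw [heγ]
      exact hyx
    rw [hyeq] at hy
    have hγtype := (cconstClass_mem_hodgePQ_iff Φ).1 hy
    exact (ComplexTorus.isConstOfType_iff_isOfTypeAt γ).2
      ((Literature.Analysis.Complex.mem_typeSubmodule_iff_isOfTypeAt hk).1 hγtype)

/-- **CLAUSE (i) OF `stub_kontsevichShadow` AT A VERY GENERAL POINT (with the skeleton's definitions
unfolded).** In every open subset of `ℂ⁵` meeting the tube domain there is a point `z₀` of the tube
domain such that for every Kuga–Satake period map `Φ` of `z₀`, every smooth projective model
`(X, φ)` of the member `ℂ⁸/(ℤ⁸ ⊕ τ(z₀)ℤ⁸)`, and the natural rationally normalised complex de Rham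
family `e` (`exists_isRational_complexDeRhamIsoFamily_holds`), the constant form of EVERY ALGEBRAIC
CLASS `c ∈ algebraicClasses X 6` — the skeleton's `constFormEquiv Φ φ hφ e c` — lies in the `ℂ`-span of
the flat Hodge forms (the skeleton's `flatHodgeForms`: forms of type `(6,6)` through every
Kuga–Satake period map of every point of the tube domain). Algebraic classes lie in the span of the
rational `(6,6)`-classes (`algebraicClasses_le_span_hodgeClasses`), whose constant forms are rational
of type `(6,6)` at `z₀` (`kgm_constForm_of_rational_hodgeClass`), hence flat at a very general `z₀`
(`kontsevichTransferKS_exists_genericMember_forms`).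
[cite: vanGeemenVerra2003QuaternionicPryms, §6.1, Rem. 6.6] [cite: LangeBirkenhake1992, §17.1] -/
theorem kontsevichTransferKS_exists_genericMember_forall (U : Set (Fin 5 → ℂ)) (hU : IsOpen U)
    (hUT : ∃ z ∈ U, (fun k => (z k).im) ∈ ksPosCone) :
    ∃ z₀ ∈ U, (fun k => (z₀ k).im) ∈ ksPosCone ∧
      ∀ (Φ : (Fin 8 ⊕ Fin 8 → ℝ) ≃L[ℝ] (Fin 8 → ℂ)), IsKSPeriodMap z₀ Φ →
        ∀ (X : Motives.SchemeOver ℂ) (hX : Motives.IsSmoothProjective 8 X)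
          (φ : ComplexTorus Φ → Motives.ComplexPoints X)
          (hφ : IsAnalytification (Fin 8 → ℂ) X 8 φ),
          ∀ e : ComplexDeRhamIsoFamily (Fin 8 → ℂ), e.IsNatural → (∀ k, IsRationalDeRhamFamily e k) →
            ∀ c ∈ algebraicClasses X 6,
              (((ComplexTorus.cconstClassEquiv Φ).symm ((e (ComplexTorus Φ) (2 * 6)).symm
                ((singularCohomology.mapIso (R := ℂ) (M := ℂ) (IsHomeomorph.homeomorph φ hφ.isHomeomorph) (2 * 6)).toLinearEquiv c))).compContinuousLinearMap
                  (Φ : (Fin 8 ⊕ Fin 8 → ℝ) →L[ℝ] (Fin 8 → ℂ))) ∈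
              Submodule.span ℂ {ω : (Fin 8 ⊕ Fin 8 → ℝ) [⋀^Fin (2 * 6)]→L[ℝ] ℂ |
                ∀ z : Fin 5 → ℂ, (fun i => (z i).im) ∈ ksPosCone →
                  ∀ Φ' : (Fin 8 ⊕ Fin 8 → ℝ) ≃L[ℝ] (Fin 8 → ℂ), IsKSPeriodMap z Φ' →
                    ComplexTorus.IsConstOfType 6 6
                      (ω.compContinuousLinearMap (Φ'.symm : (Fin 8 → ℂ) →L[ℝ] (Fin 8 ⊕ Fin 8 → ℝ)))} := by
  classical
  obtain ⟨z₀, hz₀U, hz₀T, hgen⟩ := kontsevichTransferKS_exists_genericMember_forms U hU hUT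
  refine ⟨z₀, hz₀U, hz₀T, fun Φ hΦ X hX φ hφ e he hrate c hc => ?_⟩
  -- the class ↦ constant-form map, as a `ℂ`-linear map
  let hT : ComplexTorus Φ ≃ₜ Motives.ComplexPoints X := IsHomeomorph.homeomorph φ hφ.isHomeomorph
  let pull : ((Fin 8 → ℂ) [⋀^Fin (2 * 6)]→L[ℝ] ℂ) →ₗ[ℂ] ((Fin 8 ⊕ Fin 8 → ℝ) [⋀^Fin (2 * 6)]→L[ℝ] ℂ) :=
    { toFun := fun γ => γ.compContinuousLinearMap (Φ : (Fin 8 ⊕ Fin 8 → ℝ) →L[ℝ] (Fin 8 → ℂ))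
      map_add' := fun γ γ' => by ext v; simp
      map_smul' := fun r γ => by ext v; simp }
  let L : complexBetti X (2 * 6) →ₗ[ℂ] ((Fin 8 ⊕ Fin 8 → ℝ) [⋀^Fin (2 * 6)]→L[ℝ] ℂ) :=
    pull ∘ₗ (ComplexTorus.cconstClassEquiv Φ).symm.toLinearMap ∘ₗ
      (e (ComplexTorus Φ) (2 * 6)).symm.toLinearMap ∘ₗ
        (singularCohomology.mapIso (R := ℂ) (M := ℂ) hT (2 * 6)).toLinearEquiv.toLinearMap
  have hL : ∀ c', L c' = ((ComplexTorus.cconstClassEquiv Φ).symm ((e (ComplexTorus Φ) (2 * 6)).symm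
      ((singularCohomology.mapIso (R := ℂ) (M := ℂ) hT (2 * 6)).toLinearEquiv c'))).compContinuousLinearMap
        (Φ : (Fin 8 ⊕ Fin 8 → ℝ) →L[ℝ] (Fin 8 → ℂ)) := fun _ => rfl
  rw [← hL]
  -- algebraic classes lie in the span of the rational `(6,6)`-classes, which map to flat forms
  have hspan := algebraicClasses_le_span_hodgeClasses hX 6 hc
  have key : Submodule.span ℂ {c' : complexBetti X (2 * 6) |
      IsRationalClass c' ∧ IsOfHodgeType 8 X (2 * 6) 6 6 c'} ≤
      (Submodule.span ℂ {ω : (Fin 8 ⊕ Fin 8 → ℝ) [⋀^Fin (2 * 6)]→L[ℝ] ℂ |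
        ∀ z : Fin 5 → ℂ, (fun i => (z i).im) ∈ ksPosCone →
          ∀ Φ' : (Fin 8 ⊕ Fin 8 → ℝ) ≃L[ℝ] (Fin 8 → ℂ), IsKSPeriodMap z Φ' →
            ComplexTorus.IsConstOfType 6 6
              (ω.compContinuousLinearMap (Φ'.symm : (Fin 8 → ℂ) →L[ℝ] (Fin 8 ⊕ Fin 8 → ℝ)))}).comap L := by
    refine Submodule.span_le.2 fun c' hc' => ?_
    refine Submodule.subset_span ?_
    obtain ⟨hrat', hω⟩ := kgm_constForm_of_rational_hodgeClass Φ hX φ hφ he hrate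
      (show 6 + 6 = 2 * 6 by norm_num) hc'.1 hc'.2
    rw [Set.mem_setOf_eq, hL]
    exact hgen (2 * 6) 6 (by norm_num) _ hrat' Φ hΦ hω
  exact key hspan

/-- **CLAUSE (i) OF `stub_kontsevichShadow` IN THE STUB'S OWN SHAPE** (`∃ e` natural; with the
skeleton's definitions unfolded): specialise `kontsevichTransferKS_exists_genericMember_forall` to the
natural, rationally normalised complex de Rham family of `exists_isRational_complexDeRhamIsoFamily_holds`.
[cite: vanGeemenVerra2003QuaternionicPryms, §6.1, Rem. 6.6] [cite: LangeBirkenhake1992, §17.1] -/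
theorem kontsevichTransferKS_exists_genericMember (U : Set (Fin 5 → ℂ)) (hU : IsOpen U)
    (hUT : ∃ z ∈ U, (fun k => (z k).im) ∈ ksPosCone) :
    ∃ z₀ ∈ U, (fun k => (z₀ k).im) ∈ ksPosCone ∧
      ∀ (Φ : (Fin 8 ⊕ Fin 8 → ℝ) ≃L[ℝ] (Fin 8 → ℂ)), IsKSPeriodMap z₀ Φ →
        ∀ (X : Motives.SchemeOver ℂ) (hX : Motives.IsSmoothProjective 8 X)
          (φ : ComplexTorus Φ → Motives.ComplexPoints X)
          (hφ : IsAnalytification (Fin 8 → ℂ) X 8 φ),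
          ∃ e : ComplexDeRhamIsoFamily (Fin 8 → ℂ), e.IsNatural ∧
            ∀ c ∈ algebraicClasses X 6,
              (((ComplexTorus.cconstClassEquiv Φ).symm ((e (ComplexTorus Φ) (2 * 6)).symm
                ((singularCohomology.mapIso (R := ℂ) (M := ℂ) (IsHomeomorph.homeomorph φ hφ.isHomeomorph) (2 * 6)).toLinearEquiv c))).compContinuousLinearMap
                  (Φ : (Fin 8 ⊕ Fin 8 → ℝ) →L[ℝ] (Fin 8 → ℂ))) ∈
              Submodule.span ℂ {ω : (Fin 8 ⊕ Fin 8 → ℝ) [⋀^Fin (2 * 6)]→L[ℝ] ℂ |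
                ∀ z : Fin 5 → ℂ, (fun i => (z i).im) ∈ ksPosCone →
                  ∀ Φ' : (Fin 8 ⊕ Fin 8 → ℝ) ≃L[ℝ] (Fin 8 → ℂ), IsKSPeriodMap z Φ' →
                    ComplexTorus.IsConstOfType 6 6
                      (ω.compContinuousLinearMap (Φ'.symm : (Fin 8 → ℂ) →L[ℝ] (Fin 8 ⊕ Fin 8 → ℝ)))} := by
  obtain ⟨z₀, hz₀U, hz₀T, h⟩ := kontsevichTransferKS_exists_genericMember_forall U hU hUT
  obtain ⟨e, he, hrate⟩ := exists_isRational_complexDeRhamIsoFamily_holds (Fin 8 → ℂ)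
  exact ⟨z₀, hz₀U, hz₀T, fun Φ hΦ X hX φ hφ => ⟨e, he, h Φ hΦ X hX φ hφ e he hrate⟩⟩

end Classes


/-! ### §8 The crux from the shadow hypothesis alone -/

section Composition

open Literature.AlgebraicGeometry Literature.AlgebraicGeometry.HodgeTheory
open Literature.NumberTheory.Transcendental Literature.AlgebraicTopology.SingularHomology
open CategoryTheory

/-- Selection (as in the skeleton): `a` linearly independent vectors in `span G` come with `a`
linearly independent members of `G`. [folklore] -/
theorem kgm_exists_linearIndependent_mem {K V : Type} [DivisionRing K] [AddCommGroup V] [Module K V]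
    (G : Set V) {a : ℕ} {v : Fin a → V} (hv : LinearIndependent K v)
    (hG : ∀ i, v i ∈ Submodule.span K G) :
    ∃ g : Fin a → V, (∀ i, g i ∈ G) ∧ LinearIndependent K g := by
  classical
  obtain ⟨b, hbG, hbspan, hbli⟩ := exists_linearIndependent K G
  have hv' : LinearIndependent K (fun i => (⟨v i, by rw [hbspan]; exact hG i⟩ : Submodule.span K b)) :=
    LinearIndependent.of_comp (Submodule.span K b).subtype (by exact hv)
  have hrank : Module.rank K (Submodule.span K b) = Cardinal.mk b :=
    rank_span_set (show LinearIndepOn K id b from hbli)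
  have hcard : Cardinal.mk (Fin a) ≤ Cardinal.mk b := by
    have h := hv'.cardinal_le_rank
    rwa [hrank] at h
  obtain ⟨emb⟩ := (Cardinal.le_def (Fin a) b).1 hcard
  exact ⟨fun i => (emb i : V), fun i => hbG (emb i).2, hbli.comp emb emb.injective⟩

/-- **THE CRUX `KontsevichTransferKS` FROM THE SHADOW HYPOTHESIS ALONE.** With stubs 1 and 2 of line
`birth` landed (`kontsevichTransferKS_effectiveSpan`, `kontsevichTransferKS_noWeightDrop`) and clause (i)
of stub 3 proved for the very general member (`kontsevichTransferKS_exists_genericMember_forall`), the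
skeleton's composition runs on ONE displayed hypothesis — clause (ii) of `stub_kontsevichShadow`, stated
on an open set `W` of parameters meeting the tube domain (any member of `W ∩ T`, any natural rationally
normalised de Rham family; a very general `z₀ ∈ W` is then chosen), with the skeleton's file-local
`effectiveClasses`, `tropClass = tropProj ∘ constFormEquiv` UNFOLDED: every finite family of effective
surface classes `g_* 1_V` of a model `X` is shadowed, on a non-empty open set of cusp parameters, by
EFFECTIVE tropical `(2,2)`-cycles whose period classes read out, through one injective `ℝ`-linear `Λ`,
the tropical `(6,6)`-blocks of the constant forms of the `g_* 1_V`. Proof = the skeleton's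
`KontsevichTransferKS_of` verbatim with the three landed pieces substituted.
[cite: MikhalkinZharkov2014Eigenwave, §7.1] [cite: Zharkov2020TropicalWeil, pp. 2–3]
[cite: vanGeemenVerra2003QuaternionicPryms, §6.7] -/
theorem kontsevichTransferKS_of_shadows (W : Set (Fin 5 → ℂ)) (hW : IsOpen W)
    (hWT : ∃ z ∈ W, (fun i => (z i).im) ∈ ksPosCone)
    (hShadow : ∀ z ∈ W, (fun i => (z i).im) ∈ ksPosCone →
      ∀ (Φ : (Fin 8 ⊕ Fin 8 → ℝ) ≃L[ℝ] (Fin 8 → ℂ)), IsKSPeriodMap z Φ →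
        ∀ (X : Motives.SchemeOver ℂ) (hX : Motives.IsSmoothProjective 8 X)
          (φ : ComplexTorus Φ → Motives.ComplexPoints X) (hφ : IsAnalytification (Fin 8 → ℂ) X 8 φ)
          (e : ComplexDeRhamIsoFamily (Fin 8 → ℂ)), e.IsNatural → (∀ k, IsRationalDeRhamFamily e k) →
          ∃ Λ : Matrix (Sub 8 2) (Sub 8 2) ℝ →ₗ[ℝ] Matrix (Sub 8 2) (Sub 8 2) ℂ,
            Function.Injective Λ ∧
            ∀ (a : ℕ) (g : Fin a → complexBetti X (2 * 6)),
              (∀ i, ∃ (V : Motives.SchemeOver ℂ) (hV : Motives.IsSmoothProjective 2 V) (f : V ⟶ X),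
                g i = complexGysin complexOrientationFamily hV hX f (a := 0) (b := 2 * 6) (by omega)
                  (singularCohomology.one ℂ (Motives.ComplexPoints V))) →
              ∃ U : Set (Fin 5 → ℝ), IsOpen U ∧ U.Nonempty ∧ U ⊆ ksPosCone ∧
                ∀ t ∈ U, ∃ Z : Fin a → Chain ℝ 8 2, ∀ i,
                  (Z i).IsCycle (ksMatrix t) ∧ (Z i).Effective ∧
                    Λ (compound 2 (ksMatrix t)⁻¹ * (Z i).classOf) =
                      Matrix.of fun I J : Sub 8 2 =>
                        (((ComplexTorus.cconstClassEquiv Φ).symm ((e (ComplexTorus Φ) (2 * 6)).symm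
                          ((singularCohomology.mapIso (R := ℂ) (M := ℂ)
                            (IsHomeomorph.homeomorph φ hφ.isHomeomorph) (2 * 6)).toLinearEquiv (g i)))).compContinuousLinearMap
                            (Φ : (Fin 8 ⊕ Fin 8 → ℝ) →L[ℝ] (Fin 8 → ℂ)))
                          (Fin.append (m := 6) (n := 6)
                            (fun k => (Pi.single (Sum.inr ((Finset.univ \ I.1).orderEmbOfFin (ktks_card_compl I) k)) (1 : ℝ) :
                              Fin 8 ⊕ Fin 8 → ℝ))
                            (fun k => (Pi.single (Sum.inl ((Finset.univ \ J.1).orderEmbOfFin (ktks_card_compl J) k)) (1 : ℝ) :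
                              Fin 8 ⊕ Fin 8 → ℝ)))) :
    Summit.HodgeConjecture.HodgeConjecture.Theses.TropicalKugaSatakeCayley.KontsevichTransferKS := by
  classical
  -- a very general parameter `z₀`
  obtain ⟨z₀, hz₀W, hz₀, hgen⟩ := kontsevichTransferKS_exists_genericMember_forall W hW hWT
  refine ⟨z₀, hz₀, ?_⟩
  intro Φ hΦ X hX φ hφ a α hαli hα
  obtain ⟨e, he, hrate⟩ := exists_isRational_complexDeRhamIsoFamily_holds (Fin 8 → ℂ)
  obtain ⟨Λ, hΛ, hfam⟩ := hShadow z₀ hz₀W hz₀ Φ hΦ X hX φ hφ e he hrate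
  -- the class ↦ constant form equivalence and the tropical block, unfolded
  let hT : ComplexTorus Φ ≃ₜ Motives.ComplexPoints X := IsHomeomorph.homeomorph φ hφ.isHomeomorph
  let pull : ((Fin 8 → ℂ) [⋀^Fin (2 * 6)]→L[ℝ] ℂ) ≃ₗ[ℂ] ((Fin 8 ⊕ Fin 8 → ℝ) [⋀^Fin (2 * 6)]→L[ℝ] ℂ) :=
    { toFun := fun c => c.compContinuousLinearMap (Φ : (Fin 8 ⊕ Fin 8 → ℝ) →L[ℝ] (Fin 8 → ℂ))
      invFun := fun ω => ω.compContinuousLinearMap (Φ.symm : (Fin 8 → ℂ) →L[ℝ] (Fin 8 ⊕ Fin 8 → ℝ))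
      map_add' := fun c c' => by ext v; simp
      map_smul' := fun r c => by ext v; simp
      left_inv := fun c => by ext v; simp [Function.comp_def]
      right_inv := fun ω => by ext v; simp [Function.comp_def] }
  let CF : complexBetti X (2 * 6) ≃ₗ[ℂ] ((Fin 8 ⊕ Fin 8 → ℝ) [⋀^Fin (2 * 6)]→L[ℝ] ℂ) :=
    (singularCohomology.mapIso (R := ℂ) (M := ℂ) hT (2 * 6)).toLinearEquiv ≪≫ₗ
      (e (ComplexTorus Φ) (2 * 6)).symm ≪≫ₗ (ComplexTorus.cconstClassEquiv Φ).symm ≪≫ₗ pull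
  have hCF : ∀ c, CF c = ((ComplexTorus.cconstClassEquiv Φ).symm ((e (ComplexTorus Φ) (2 * 6)).symm
      ((singularCohomology.mapIso (R := ℂ) (M := ℂ) hT (2 * 6)).toLinearEquiv c))).compContinuousLinearMap
        (Φ : (Fin 8 ⊕ Fin 8 → ℝ) →L[ℝ] (Fin 8 → ℂ)) := fun _ => rfl
  let TP : ((Fin 8 ⊕ Fin 8 → ℝ) [⋀^Fin (2 * 6)]→L[ℝ] ℂ) →ₗ[ℂ] Matrix (Sub 8 2) (Sub 8 2) ℂ :=
    { toFun := fun ω => Matrix.of fun I J : Sub 8 2 =>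
        ω (Fin.append (m := 6) (n := 6)
          (fun k => (Pi.single (Sum.inr ((Finset.univ \ I.1).orderEmbOfFin (ktks_card_compl I) k)) (1 : ℝ) :
            Fin 8 ⊕ Fin 8 → ℝ))
          (fun k => (Pi.single (Sum.inl ((Finset.univ \ J.1).orderEmbOfFin (ktks_card_compl J) k)) (1 : ℝ) :
            Fin 8 ⊕ Fin 8 → ℝ)))
      map_add' := fun _ _ => by ext I J; rfl
      map_smul' := fun _ _ => by ext I J; rfl }
  let TC : complexBetti X (2 * 6) →ₗ[ℂ] Matrix (Sub 8 2) (Sub 8 2) ℂ := TP ∘ₗ CF.toLinearMap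
  -- STUB 1: the algebraic classes are spanned by the effective surface classes
  have hspan := kontsevichTransferKS_effectiveSpan 6 2 rfl X hX
  set G : Set (complexBetti X (2 * 6)) := {c : complexBetti X (2 * 6) | ∃ (V : Motives.SchemeOver ℂ)
      (hV : Motives.IsSmoothProjective 2 V) (g : V ⟶ X),
      c = complexGysin complexOrientationFamily hV hX g (a := 0) (b := 2 * 6) (by omega)
        (singularCohomology.one ℂ (Motives.ComplexPoints V))} with hGdef
  have hGalg : G ⊆ (algebraicClasses X 6 : Set (complexBetti X (2 * 6))) := by
    rw [← hspan]; exact Submodule.subset_span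
  -- selection: `a` independent effective generators
  obtain ⟨g, hgG, hgli⟩ := kgm_exists_linearIndependent_mem G hαli
    (fun i => by rw [hspan]; exact (hα i).2.2)
  -- STUB 3 (ii): shadows of the generators on an open set of cusp parameters
  obtain ⟨U, hUo, hUne, hUs, hU⟩ := hfam a g (fun i => hgG i)
  refine ⟨U, hUo, hUne, hUs, fun t ht => ?_⟩
  obtain ⟨Z, hZ⟩ := hU t ht
  refine ⟨Z, fun i => ⟨(hZ i).1, (hZ i).2.1⟩, ?_⟩
  -- clause (i) at the very general `z₀` + STUB 2: the tropical class map is injective on `span g`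
  have hflat : ∀ c ∈ algebraicClasses X 6, CF c ∈ Submodule.span ℂ
      {ω : (Fin 8 ⊕ Fin 8 → ℝ) [⋀^Fin (2 * 6)]→L[ℝ] ℂ |
        ∀ z : Fin 5 → ℂ, (fun i => (z i).im) ∈ ksPosCone →
          ∀ Φ' : (Fin 8 ⊕ Fin 8 → ℝ) ≃L[ℝ] (Fin 8 → ℂ), IsKSPeriodMap z Φ' →
            ComplexTorus.IsConstOfType 6 6
              (ω.compContinuousLinearMap (Φ'.symm : (Fin 8 → ℂ) →L[ℝ] (Fin 8 ⊕ Fin 8 → ℝ)))} :=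
    fun c hc => by rw [hCF]; exact hgen Φ hΦ X hX φ hφ e he hrate c hc
  have hdisj : Disjoint (Submodule.span ℂ (Set.range g)) (LinearMap.ker TC) := by
    rw [Submodule.disjoint_def]
    intro x hx hker
    have hxalg : x ∈ algebraicClasses X 6 :=
      (Submodule.span_le.2 (Set.range_subset_iff.2 fun i => hGalg (hgG i))) hx
    have hzero : CF x = 0 := by
      refine kontsevichTransferKS_noWeightDrop (CF x) (hflat x hxalg) fun I J => ?_
      have h0 : TC x = 0 := LinearMap.mem_ker.1 hker
      exact congrFun (congrFun h0 I) J
    exact (LinearEquiv.map_eq_zero_iff CF).1 hzero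
  have h1 : LinearIndependent ℂ (TC ∘ g) := hgli.map hdisj
  have h2 : LinearIndependent ℝ (TC ∘ g) := h1.restrict_scalars' ℝ
  have h3 : (TC ∘ g) = Λ ∘ fun i => compound 2 (ksMatrix t)⁻¹ * (Z i).classOf := by
    funext i
    exact ((hZ i).2.2).symm
  rw [h3] at h2
  exact LinearIndependent.of_comp Λ h2

end Composition

end Summit.HodgeConjecture.HodgeConjecture.Theorems

end
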